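import Literature.NumberTheory.LFunctions.FeketePolyaKernelCertificatesWeightedWrappers
import HarnessLib

/-!
# Reweighted Fekete–Pólya certificates with QUADRATIC Euler-type factors

Topic `Literature/NumberTheory/LFunctions`; namespace `Literature.NumberTheory.LFunctions.FeketePolyaKernel`
(sequel of `FeketePolyaKernelCertificatesWeightedWrappers.lean`). Small computable definitions (`twOf2`) and
THEOREMS (no named fact, no `sorry`). The engine of the previous file for a GENERAL term list `tw = [(d, c_d)]` with
`G(σ) = Σ c_d d^{−σ} > 0` and `a(1) = ℜχ(1)` (`lfunction_ne_zero_of_rwCertTw`), and factor lists with quadratic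
terms: `fs = [(p, ε, κ)]` stands for `G(s) = ∏ (1 + ε p^{−s} + κ p^{−2s})` with `p ≥ 2`, `ε ∈ {0, ±1}`, `κ ∈ {0, 1}`
(every factor is `≥ 1 − p^{−σ} > 0`); `twOf2 fs` is its expansion; wrappers `good_{odd,even}_of_{odd,four,eight}_rw2`.
These add the factors `1 + p^{−2s}` and `1 ± p^{−s} + p^{−2s}` to the reweighting menu of the Fekete–Pólya lane (cell
`parity-realchar`, seat prover-2): a few more percent of the conductors with no plain witness get a kernel certificate.

## References

* H. L. Montgomery, R. C. Vaughan, *Multiplicative Number Theory I*, CUP 2007, §9.3 Thm 9.13, §11.2.1 Exercises 7–8.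
  [MontgomeryVaughan2007]
-/

namespace Literature.NumberTheory.LFunctions

namespace FeketePolyaKernel

open Finset Literature.Analysis.Convolution FeketePolyaTable FeketePolyaReweighted
  Literature.Barriers.RiemannHypothesis PrimitiveQuadratic SmallModuli OddSmallModuliII
open scoped NumberTheorySymbols

/-! ### The engine for a general term list -/

/-- **The engine for reweighted streams, general term list.** `χ ≠ χ₀` quadratic mod `q` with `ℜχ = v`, a term list
`tw = [(d, c)]` (`d ≥ 1`, `c = ±1`) with `G(σ) = Σ c d^{−σ} > 0` for all `σ > 0` and `a(1) = ℜχ(1)`, a period `N ≥ 1` with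
`d·q ∣ N`, `K ≥ 1`, `b ≥ 2`, `|tw| < 2^b`, and a passing `blockCertD` on the weight tables: then `L(σ, χ) ≠ 0` for `σ > 0`.
[cite: MontgomeryVaughan2007, §11.2.1 Exercises 7 (g), 8] -/
theorem lfunction_ne_zero_of_rwCertTw {q : ℕ} [NeZero q] (χ : DirichletCharacter ℂ q) (hχ : χ ≠ 1)
    (hquad : χ.IsQuadratic) (v : ℕ → ℤ) (hv : ∀ n : ℕ, (χ (n : ZMod q)).re = v n)
    (tw : List (ℕ × ℤ)) (htwp : ∀ dc ∈ tw, 1 ≤ dc.1 ∧ (dc.2 = 1 ∨ dc.2 = -1))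
    (hG : ∀ σ : ℝ, 0 < σ → 0 < rwG tw σ) (hone : rwSeq χ tw 1 = (χ ((1 : ℕ) : ZMod q)).re) {N K b e : ℕ} (hN : 1 ≤ N)
    (hqN : ∀ dc ∈ tw, dc.1 * q ∣ N) (hK : 1 ≤ K) (hb : 2 ≤ b) (hD : tw.length < 2 ^ b)
    (h : blockCertD b e K N tw.length (kpack b N (rwDp v tw), kpack b N (rwDm v tw)) = true)
    {σ : ℝ} (hσ : 0 < σ) : χ.LFunction (σ : ℂ) ≠ 0 := by
  -- the value function `v`
  have hv0 : v 0 = 0 := by exact_mod_cast (hv 0).symm.trans (re_apply_natCast_zero χ hχ)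
  have hvper : ∀ n, v (n + q) = v n := fun n => by
    have := hv (n + q)
    rw [Nat.cast_add, ZMod.natCast_self, add_zero, hv n] at this
    exact_mod_cast this.symm
  have hv3 : ∀ n, Val3 (v n) := fun n ↦ by
    rcases hquad (n : ZMod q) with h0 | h1 | h2
    · left; exact_mod_cast (by rw [← hv, h0, Complex.zero_re] : (v n : ℝ) = 0)
    · right; left; exact_mod_cast (by rw [← hv, h1, Complex.one_re] : (v n : ℝ) = 1)
    · right; right
      exact_mod_cast (by rw [← hv, h2, Complex.neg_re, Complex.one_re] : (v n : ℝ) = -1)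
  -- the integer stream and the certificate
  set x : ℕ → ℤ := rwValZ v tw with hx
  have hxper : ∀ n, x (n + N) = x n := rwValZ_add_period hvper tw fun dc hdc => ⟨(htwp dc hdc).1, hqN dc hdc⟩
  have hx0 : x 0 = 0 := by
    simp only [hx, rwValZ]
    rw [List.sum_eq_zero]
    intro y hy
    rw [List.mem_map] at hy
    obtain ⟨dc, -, rfl⟩ := hy
    simp [hv0]
  have hxN : x N = 0 := by rw [← zero_add N, hxper, hx0]
  obtain ⟨hle, _⟩ := And.intro (rwDp_le v tw) trivial
  obtain ⟨hA, hB⟩ := blockCertD_sound hb hD hK hN hx0 hxN (fun n => (rwDp_le v tw n).1)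
    (fun n => (rwDp_le v tw n).2) (rwDp_sub_rwDm hv3 tw fun dc hdc => (htwp dc hdc).2) rfl h
  -- one period suffices
  set l : List ℤ := (List.range N).map x with hl
  have hlen : l.length = N := by simp [hl]
  have htab : ∀ n, tableVal l n = x n := fun n => by
    rw [tableVal, hlen, hl, List.getD_eq_getElem?_getD, List.getElem?_map,
      List.getElem?_range (Nat.mod_lt n (by omega))]
    exact periodic_mod' hxper n
  have hips : ∀ k n, itS x k n = ipsum l k n := itS_eq_ipsum htab
  have hnonneg : ∀ M, 1 ≤ M → 0 ≤ ipsum l K M :=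
    ipsum_nonneg_of_period l (by omega) (fun j hj hjK => by rw [hlen, ← hips]; exact hB j hj hjK)
      fun M _ hMN => by rw [← hips]; exact hA M (by omega)
  -- the real stream is `rwSeq χ tw`
  have hfun : (fun n : ℕ ↦ ((tableVal l n : ℤ) : ℝ)) = rwSeq χ tw := by
    funext n; rw [htab, hx, cast_rwValZ χ hv]
  have hk : ∀ M, 1 ≤ M → 0 ≤ iterSummatory (rwSeq χ tw) K M := fun M hM => by
    rw [← hfun, ← ipsum_cast_real]
    exact_mod_cast hnonneg M hM
  have h1 : 0 < rwSeq χ tw 1 := by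
    rw [hone, Nat.cast_one, map_one, Complex.one_re]; exact one_pos
  exact lfunction_ne_zero_of_reweighted χ hχ tw (fun dc hdc => (htwp dc hdc).1) hσ (hG σ hσ)
    (abs_rwSeq_le χ tw fun dc hdc => (htwp dc hdc).2) h1
    (abs_summatory_rwSeq_le χ hχ tw htwp) hk


/-! ### Quadratic factor lists -/

/-- The terms `(m·d, c·c_d)` over a term list (empty when `c = 0`). [cite: MontgomeryVaughan2007, §11.2.1 Exercise 8] -/
def optTerms (m : ℕ) (c : ℤ) (T : List (ℕ × ℤ)) : List (ℕ × ℤ) :=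
  if c = 0 then [] else T.map fun dc => (m * dc.1, c * dc.2)

/-- **Expansion of a quadratic factor list**: `(p, ε, κ)` contributes the terms `(p·d, ε·c)` and `(p²·d, κ·c)` (dropped
when the coefficient is `0`) on top of the expansion `T` of the rest: the terms of `(1 + ε p^{−s} + κ p^{−2s})·Σ_T`.
[cite: MontgomeryVaughan2007, §11.2.1 Exercise 8] -/
def twOf2 : List (ℕ × ℤ × ℤ) → List (ℕ × ℤ)
  | [] => [(1, 1)]
  | (p, ε, κ) :: rest => twOf2 rest ++ (optTerms p ε (twOf2 rest) ++ optTerms (p * p) κ (twOf2 rest))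

/-- Entries of `optTerms m c T`: `d ≥ 2` when `m ≥ 2`, `c'` a product `c·c_d`. [cite: MontgomeryVaughan2007, §11.2.1 Exercise 8] -/
theorem mem_optTerms {m : ℕ} {c : ℤ} {T : List (ℕ × ℤ)} {dc : ℕ × ℤ} (h : dc ∈ optTerms m c T) :
    c ≠ 0 ∧ ∃ dc' ∈ T, dc = (m * dc'.1, c * dc'.2) := by
  unfold optTerms at h
  split_ifs at h with hc
  · simp at h
  · rw [List.mem_map] at h
    obtain ⟨dc', h1, rfl⟩ := h
    exact ⟨hc, dc', h1, rfl⟩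

/-- `G(σ)` over `optTerms m c T` is `c·m^{−σ}·G_T(σ)` (`m ≥ 1`). [cite: MontgomeryVaughan2007, §11.2.1 Exercise 8] -/
theorem rwG_optTerms (σ : ℝ) {m : ℕ} (hm : 1 ≤ m) (c : ℤ) (T : List (ℕ × ℤ)) :
    rwG (optTerms m c T) σ = (c : ℝ) * (m : ℝ) ^ (-σ) * rwG T σ := by
  unfold optTerms rwG
  split_ifs with hc
  · simp [hc]
  · rw [← List.sum_map_mul_left, List.map_map]
    congr 1
    refine List.map_congr_left fun dc _ => ?_
    simp only [Function.comp]
    push_cast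
    rw [Real.mul_rpow (by positivity) (by positivity)]
    ring

/-- Entries of the quadratic expansion: `d ≥ 1` and `c = ±1`. [cite: MontgomeryVaughan2007, §11.2.1 Exercise 8] -/
theorem twOf2_props : ∀ fs : List (ℕ × ℤ × ℤ),
    (∀ pe ∈ fs, 2 ≤ pe.1 ∧ (pe.2.1 = 1 ∨ pe.2.1 = 0 ∨ pe.2.1 = -1) ∧ (pe.2.2 = 1 ∨ pe.2.2 = 0)) →
    ∀ dc ∈ twOf2 fs, 1 ≤ dc.1 ∧ (dc.2 = 1 ∨ dc.2 = -1)
  | [], _, dc, hdc => by simp [twOf2] at hdc; subst hdc; simp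
  | (p, ε, κ) :: rest, h, dc, hdc => by
    have hp : 2 ≤ p ∧ (ε = 1 ∨ ε = 0 ∨ ε = -1) ∧ (κ = 1 ∨ κ = 0) := h (p, ε, κ) (by simp)
    have ih := twOf2_props rest fun pe hpe => h pe (by simp [hpe])
    simp only [twOf2, List.mem_append] at hdc
    rcases hdc with hdc | hdc | hdc
    · exact ih dc hdc
    · obtain ⟨hε, dc', hdc', rfl⟩ := mem_optTerms hdc
      obtain ⟨h1, h2⟩ := ih dc' hdc'
      refine ⟨le_trans h1 (Nat.le_mul_of_pos_left _ (by omega)), ?_⟩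
      rcases hp.2.1 with hε' | hε' | hε' <;> rcases h2 with hc | hc <;> simp_all
    · obtain ⟨hκ, dc', hdc', rfl⟩ := mem_optTerms hdc
      obtain ⟨h1, h2⟩ := ih dc' hdc'
      refine ⟨le_trans h1 (Nat.le_mul_of_pos_left _ (Nat.mul_pos (by omega) (by omega))), ?_⟩
      rcases hp.2.2 with hκ' | hκ' <;> rcases h2 with hc | hc <;> simp_all

/-- `rwG` is additive in the list. [cite: MontgomeryVaughan2007, §11.2.1 Exercise 8] -/
private theorem rwG_append (l₁ l₂ : List (ℕ × ℤ)) (σ : ℝ) : rwG (l₁ ++ l₂) σ = rwG l₁ σ + rwG l₂ σ := by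
  simp [rwG, List.map_append, List.sum_append]

/-- `G(σ)` of the quadratic expansion is `∏ (1 + ε p^{−σ} + κ p^{−2σ})`. [cite: MontgomeryVaughan2007, §11.2.1 Exercise 8] -/
theorem rwG_twOf2 (σ : ℝ) : ∀ fs : List (ℕ × ℤ × ℤ), (∀ pe ∈ fs, 2 ≤ pe.1) →
    rwG (twOf2 fs) σ = (fs.map fun pe => 1 + (pe.2.1 : ℝ) * (pe.1 : ℝ) ^ (-σ) +
      (pe.2.2 : ℝ) * ((pe.1 : ℝ) ^ (-σ) * (pe.1 : ℝ) ^ (-σ))).prod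
  | [], _ => by simp [twOf2, rwG]
  | (p, ε, κ) :: rest, h => by
    have hp : 2 ≤ p := h (p, ε, κ) (by simp)
    have ih := rwG_twOf2 σ rest fun pe hpe => h pe (by simp [hpe])
    rw [twOf2, rwG_append, rwG_append, rwG_optTerms σ (by omega), rwG_optTerms σ (by nlinarith), ih, List.map_cons,
      List.prod_cons]
    have hp2 : ((p * p : ℕ) : ℝ) ^ (-σ) = (p : ℝ) ^ (-σ) * (p : ℝ) ^ (-σ) := by
      push_cast; rw [Real.mul_rpow (by positivity) (by positivity)]
    rw [hp2]
    ring

/-- `G(σ) > 0` for `σ > 0`: each factor is `≥ 1 − p^{−σ} > 0`. [cite: MontgomeryVaughan2007, §11.2.1 Exercise 8] -/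
theorem rwG_twOf2_pos {σ : ℝ} (hσ : 0 < σ) (fs : List (ℕ × ℤ × ℤ))
    (hfs : ∀ pe ∈ fs, 2 ≤ pe.1 ∧ (pe.2.1 = 1 ∨ pe.2.1 = 0 ∨ pe.2.1 = -1) ∧ (pe.2.2 = 1 ∨ pe.2.2 = 0)) :
    0 < rwG (twOf2 fs) σ := by
  rw [rwG_twOf2 σ fs fun pe hpe => (hfs pe hpe).1]
  refine List.prod_pos fun x hx => ?_
  rw [List.mem_map] at hx
  obtain ⟨pe, hpe, rfl⟩ := hx
  obtain ⟨hp, hε, hκ⟩ := hfs pe hpe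
  have hp1 : (1 : ℝ) < pe.1 := by exact_mod_cast (show 1 < pe.1 by omega)
  have hlt : (pe.1 : ℝ) ^ (-σ) < 1 := Real.rpow_lt_one_of_one_lt_of_neg hp1 (by linarith)
  have h0 : 0 ≤ (pe.1 : ℝ) ^ (-σ) := by positivity
  have hsq : 0 ≤ (pe.1 : ℝ) ^ (-σ) * (pe.1 : ℝ) ^ (-σ) := mul_nonneg h0 h0
  rcases hε with h | h | h <;> rcases hκ with h' | h' <;> rw [h, h'] <;> push_cast <;> nlinarith

/-- `rwSeq` is additive in the list. [cite: MontgomeryVaughan2007, §11.2.1 Exercise 8] -/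
private theorem rwSeq_append' {q : ℕ} (χ : DirichletCharacter ℂ q) (l₁ l₂ : List (ℕ × ℤ)) (n : ℕ) :
    rwSeq χ (l₁ ++ l₂) n = rwSeq χ l₁ n + rwSeq χ l₂ n := by
  simp [rwSeq, List.map_append, List.sum_append]

/-- The dilated terms vanish at `n = 1` (`m ≥ 2`). [cite: MontgomeryVaughan2007, §11.2.1 Exercise 8] -/
private theorem rwSeq_optTerms_one {q : ℕ} (χ : DirichletCharacter ℂ q) {m : ℕ} (hm : 2 ≤ m) (c : ℤ)
    {T : List (ℕ × ℤ)} (hT : ∀ dc ∈ T, 1 ≤ dc.1) : rwSeq χ (optTerms m c T) 1 = 0 := by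
  unfold rwSeq
  rw [List.sum_eq_zero]
  intro x hx
  rw [List.mem_map] at hx
  obtain ⟨dc, hdc, rfl⟩ := hx
  obtain ⟨-, dc', hdc', rfl⟩ := mem_optTerms hdc
  have hd := hT dc' hdc'
  simp only
  rw [if_neg]
  intro hdiv
  have := Nat.le_of_dvd one_pos hdiv
  nlinarith

/-- `a(1) = ℜχ(1)` for the quadratic expansion. [cite: MontgomeryVaughan2007, §11.2.1 Exercise 8] -/
theorem rwSeq_twOf2_one {q : ℕ} (χ : DirichletCharacter ℂ q) : ∀ fs : List (ℕ × ℤ × ℤ),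
    (∀ pe ∈ fs, 2 ≤ pe.1 ∧ (pe.2.1 = 1 ∨ pe.2.1 = 0 ∨ pe.2.1 = -1) ∧ (pe.2.2 = 1 ∨ pe.2.2 = 0)) →
    rwSeq χ (twOf2 fs) 1 = (χ ((1 : ℕ) : ZMod q)).re
  | [], _ => by simp [twOf2, rwSeq]
  | (p, ε, κ) :: rest, h => by
    have hp : 2 ≤ p := (h (p, ε, κ) (by simp)).1
    have hrest : ∀ pe ∈ rest, 2 ≤ pe.1 ∧ (pe.2.1 = 1 ∨ pe.2.1 = 0 ∨ pe.2.1 = -1) ∧ (pe.2.2 = 1 ∨ pe.2.2 = 0) :=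
      fun pe hpe => h pe (by simp [hpe])
    have hT : ∀ dc ∈ twOf2 rest, 1 ≤ dc.1 := fun dc hdc => (twOf2_props rest hrest dc hdc).1
    rw [twOf2, rwSeq_append', rwSeq_append', rwSeq_twOf2_one χ rest hrest, rwSeq_optTerms_one χ hp ε hT,
      rwSeq_optTerms_one χ (by nlinarith) κ hT, add_zero, add_zero]

/-! ### Per-conductor wrappers, quadratic factor lists -/

/-- A product of odd numbers is odd. [folklore] -/
private theorem prod_mod_two''' : ∀ (ps : List ℕ), (∀ p ∈ ps, p % 2 = 1) → ps.prod % 2 = 1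
  | [], _ => rfl
  | p :: rest, h => by
    rw [List.prod_cons, Nat.mul_mod, h p (by simp), prod_mod_two''' rest fun p' hp' ↦ h p' (by simp [hp'])]

/-- All entries of the factor list are odd primes. [folklore] -/
private theorem odd_of_forall'' {ps : List ℕ} (hps : ps.Forall fun p ↦ p.Prime ∧ p ≠ 2) :
    (∀ p ∈ ps, p % 2 = 1) ∧ (∀ p ∈ ps, 1 ≤ p) := by
  rw [List.forall_iff_forall_mem] at hps
  exact ⟨fun p hp ↦ (hps p hp).1.eq_two_or_odd.resolve_left (hps p hp).2, fun p hp => (hps p hp).1.one_lt.le⟩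

/-- Primitive characters of modulus `≥ 2` are non-trivial. [folklore] -/
private theorem ne_one'''' {q : ℕ} [NeZero q] {χ : DirichletCharacter ℂ q} (hprim : χ.IsPrimitive)
    (hq : 2 ≤ q) : χ ≠ 1 :=
  SiegelZeroQuality.ne_one_of_isPrimitive hprim hq

/-- The generic wrapper: from the side conditions, the value identification `ℜχ = plainVal kind (resTable ps)`
for every primitive quadratic `χ` of the given parity, and a passing certificate, to `L(σ, χ) ≠ 0`.
[cite: MontgomeryVaughan2007, §11.2.1 Exercises 7 (g), 8] -/
theorem good_of_rwCert2 {q : ℕ} [NeZero q] (hq : 2 ≤ q) (kind : ℕ) (ps : List ℕ) (hps1 : ∀ p ∈ ps, 1 ≤ p)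
    (fs : List (ℕ × ℤ × ℤ)) {N K b e : ℕ} (hfs : ∀ pe ∈ fs, 2 ≤ pe.1 ∧ (pe.2.1 = 1 ∨ pe.2.1 = 0 ∨ pe.2.1 = -1) ∧ (pe.2.2 = 1 ∨ pe.2.2 = 0))
    (htw : ∀ dc ∈ twOf2 fs, dc.1 ∣ N ∧ (∀ p ∈ ps, p ∣ N / dc.1) ∧ kindPeriod kind ∣ N / dc.1 ∧ dc.1 * q ∣ N)
    (hN : 1 ≤ N) (hK : 1 ≤ K) (hb : 2 ≤ b) (hD : (twOf2 fs).length < 2 ^ b)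
    (h : blockCertD b e K N (twOf2 fs).length (rwTabs kind b ps N (twOf2 fs)) = true)
    (χ : DirichletCharacter ℂ q) (hquad : χ.IsQuadratic) (hprim : χ.IsPrimitive)
    (hv : ∀ n : ℕ, (χ (n : ZMod q)).re = plainVal kind (resTable ps) n) :
    ∀ σ : ℝ, 0 < σ → σ < 1 → χ.LFunction σ ≠ 0 := by
  intro σ hσ _
  have htwp := twOf2_props fs hfs
  rw [rwTabs_eq (kind := kind) hb ps hps1 (twOf2 fs) (fun dc hdc => ⟨(htwp dc hdc).1, (htw dc hdc).1,
    (htw dc hdc).2.1, (htw dc hdc).2.2.1⟩)] at h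
  exact lfunction_ne_zero_of_rwCertTw χ (ne_one'''' hprim hq) hquad _ hv (twOf2 fs) htwp
    (fun σ' hσ' => rwG_twOf2_pos hσ' fs hfs) (rwSeq_twOf2_one χ fs hfs) hN (fun dc hdc => (htw dc hdc).2.2.2)
    hK hb hD h hσ

/-- **Odd characters, odd conductor `q = ∏ ps`**: parity test or reweighted certificate (kind `0`).
[cite: MontgomeryVaughan2007, §11.2.1 Exercises 7 (g), 8] -/
theorem good_odd_of_odd_rw2 {q : ℕ} [NeZero q] (ps : List ℕ) (hps : ps.Forall fun p ↦ p.Prime ∧ p ≠ 2)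
    (hprod : ps.prod = q) (hq1 : 1 < q) (fs : List (ℕ × ℤ × ℤ)) (N K b e : ℕ) (hfs : ∀ pe ∈ fs, 2 ≤ pe.1 ∧ (pe.2.1 = 1 ∨ pe.2.1 = 0 ∨ pe.2.1 = -1) ∧ (pe.2.2 = 1 ∨ pe.2.2 = 0))
    (htw : ∀ dc ∈ twOf2 fs, dc.1 ∣ N ∧ (∀ p ∈ ps, p ∣ N / dc.1) ∧ kindPeriod 0 ∣ N / dc.1 ∧ dc.1 * q ∣ N)
    (hN : 1 ≤ N) (hK : 1 ≤ K) (hb : 2 ≤ b) (hD : (twOf2 fs).length < 2 ^ b)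
    (h : valOddR (resTable ps) (q - 1) = 1 ∨ blockCertD b e K N (twOf2 fs).length (rwTabs 0 b ps N (twOf2 fs)) = true) :
    ∀ χ : DirichletCharacter ℂ q, χ.IsQuadratic → χ.IsPrimitive → χ.Odd →
      ∀ σ : ℝ, 0 < σ → σ < 1 → χ.LFunction σ ≠ 0 := by
  obtain ⟨hodd, hps1⟩ := odd_of_forall'' hps
  have hq2 : q % 2 = 1 := hprod ▸ prod_mod_two''' ps hodd
  intro χ hquad hprim hpar
  have hv : ∀ n : ℕ, (χ (n : ZMod q)).re = valOddR (resTable ps) n := fun n ↦ by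
    rw [valOddR_eq hps hprod hq1, re_apply_eq_valOdd (Nat.odd_iff.mpr hq2) hq1 hprim hquad]
  rcases h with hp | hrun
  · exact fun σ _ _ => (not_odd_of_val _ hv hp hpar).elim
  · exact good_of_rwCert2 (by omega) 0 ps hps1 fs hfs htw hN hK hb hD hrun χ hquad hprim hv

/-- **Even characters, odd conductor**: parity test or reweighted certificate (kind `0`). [cite: MontgomeryVaughan2007, §11.2.1 Exercises 7 (g), 8] -/
theorem good_even_of_odd_rw2 {q : ℕ} [NeZero q] (ps : List ℕ) (hps : ps.Forall fun p ↦ p.Prime ∧ p ≠ 2)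
    (hprod : ps.prod = q) (hq1 : 1 < q) (fs : List (ℕ × ℤ × ℤ)) (N K b e : ℕ) (hfs : ∀ pe ∈ fs, 2 ≤ pe.1 ∧ (pe.2.1 = 1 ∨ pe.2.1 = 0 ∨ pe.2.1 = -1) ∧ (pe.2.2 = 1 ∨ pe.2.2 = 0))
    (htw : ∀ dc ∈ twOf2 fs, dc.1 ∣ N ∧ (∀ p ∈ ps, p ∣ N / dc.1) ∧ kindPeriod 0 ∣ N / dc.1 ∧ dc.1 * q ∣ N)
    (hN : 1 ≤ N) (hK : 1 ≤ K) (hb : 2 ≤ b) (hD : (twOf2 fs).length < 2 ^ b)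
    (h : valOddR (resTable ps) (q - 1) = -1 ∨ blockCertD b e K N (twOf2 fs).length (rwTabs 0 b ps N (twOf2 fs)) = true) :
    ∀ χ : DirichletCharacter ℂ q, χ.IsQuadratic → χ.IsPrimitive → χ.Even →
      ∀ σ : ℝ, 0 < σ → σ < 1 → χ.LFunction σ ≠ 0 := by
  obtain ⟨hodd, hps1⟩ := odd_of_forall'' hps
  have hq2 : q % 2 = 1 := hprod ▸ prod_mod_two''' ps hodd
  intro χ hquad hprim hpar
  have hv : ∀ n : ℕ, (χ (n : ZMod q)).re = valOddR (resTable ps) n := fun n ↦ by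
    rw [valOddR_eq hps hprod hq1, re_apply_eq_valOdd (Nat.odd_iff.mpr hq2) hq1 hprim hquad]
  rcases h with hp | hrun
  · exact fun σ _ _ => (not_even_of_val _ hv hp hpar).elim
  · exact good_of_rwCert2 (by omega) 0 ps hps1 fs hfs htw hN hK hb hD hrun χ hquad hprim hv

/-- **Odd characters, conductor `4m`, `m = ∏ ps`**: parity test or reweighted certificate (kind `1`).
[cite: MontgomeryVaughan2007, §11.2.1 Exercises 7 (g), 8] -/
theorem good_odd_of_four_rw2 {q : ℕ} [NeZero q] (ps : List ℕ) (hps : ps.Forall fun p ↦ p.Prime ∧ p ≠ 2)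
    (hprod : 4 * ps.prod = q) (hq1 : 4 < q) (fs : List (ℕ × ℤ × ℤ)) (N K b e : ℕ) (hfs : ∀ pe ∈ fs, 2 ≤ pe.1 ∧ (pe.2.1 = 1 ∨ pe.2.1 = 0 ∨ pe.2.1 = -1) ∧ (pe.2.2 = 1 ∨ pe.2.2 = 0))
    (htw : ∀ dc ∈ twOf2 fs, dc.1 ∣ N ∧ (∀ p ∈ ps, p ∣ N / dc.1) ∧ kindPeriod 1 ∣ N / dc.1 ∧ dc.1 * q ∣ N)
    (hN : 1 ≤ N) (hK : 1 ≤ K) (hb : 2 ≤ b) (hD : (twOf2 fs).length < 2 ^ b)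
    (h : valFourR (resTable ps) (q - 1) = 1 ∨ blockCertD b e K N (twOf2 fs).length (rwTabs 1 b ps N (twOf2 fs)) = true) :
    ∀ χ : DirichletCharacter ℂ q, χ.IsQuadratic → χ.IsPrimitive → χ.Odd →
      ∀ σ : ℝ, 0 < σ → σ < 1 → χ.LFunction σ ≠ 0 := by
  obtain ⟨hodd, hps1⟩ := odd_of_forall'' hps
  subst hprod
  set m := ps.prod with hm
  haveI : NeZero m := ⟨by omega⟩
  have hm2 : m % 2 = 1 := prod_mod_two''' ps hodd
  intro χ hquad hprim hpar
  have hv : ∀ n : ℕ, (χ (n : ZMod (2 ^ 2 * m))).re = valFourR (resTable ps) n := fun n ↦ by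
    rw [valFourR_eq hps hm.symm (by omega), re_apply_eq_valFour (m := m) (Nat.odd_iff.mpr hm2) (by omega)
      hprim hquad]
  rcases h with hp | hrun
  · exact fun σ _ _ => (not_odd_of_val _ hv hp hpar).elim
  · exact good_of_rwCert2 (by omega) 1 ps hps1 fs hfs htw hN hK hb hD hrun χ hquad hprim hv

/-- **Even characters, conductor `4m`**: parity test or reweighted certificate (kind `1`). [cite: MontgomeryVaughan2007, §11.2.1 Exercises 7 (g), 8] -/
theorem good_even_of_four_rw2 {q : ℕ} [NeZero q] (ps : List ℕ) (hps : ps.Forall fun p ↦ p.Prime ∧ p ≠ 2)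
    (hprod : 4 * ps.prod = q) (hq1 : 4 < q) (fs : List (ℕ × ℤ × ℤ)) (N K b e : ℕ) (hfs : ∀ pe ∈ fs, 2 ≤ pe.1 ∧ (pe.2.1 = 1 ∨ pe.2.1 = 0 ∨ pe.2.1 = -1) ∧ (pe.2.2 = 1 ∨ pe.2.2 = 0))
    (htw : ∀ dc ∈ twOf2 fs, dc.1 ∣ N ∧ (∀ p ∈ ps, p ∣ N / dc.1) ∧ kindPeriod 1 ∣ N / dc.1 ∧ dc.1 * q ∣ N)
    (hN : 1 ≤ N) (hK : 1 ≤ K) (hb : 2 ≤ b) (hD : (twOf2 fs).length < 2 ^ b)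
    (h : valFourR (resTable ps) (q - 1) = -1 ∨ blockCertD b e K N (twOf2 fs).length (rwTabs 1 b ps N (twOf2 fs)) = true) :
    ∀ χ : DirichletCharacter ℂ q, χ.IsQuadratic → χ.IsPrimitive → χ.Even →
      ∀ σ : ℝ, 0 < σ → σ < 1 → χ.LFunction σ ≠ 0 := by
  obtain ⟨hodd, hps1⟩ := odd_of_forall'' hps
  subst hprod
  set m := ps.prod with hm
  haveI : NeZero m := ⟨by omega⟩
  have hm2 : m % 2 = 1 := prod_mod_two''' ps hodd
  intro χ hquad hprim hpar
  have hv : ∀ n : ℕ, (χ (n : ZMod (2 ^ 2 * m))).re = valFourR (resTable ps) n := fun n ↦ by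
    rw [valFourR_eq hps hm.symm (by omega), re_apply_eq_valFour (m := m) (Nat.odd_iff.mpr hm2) (by omega)
      hprim hquad]
  rcases h with hp | hrun
  · exact fun σ _ _ => (not_even_of_val _ hv hp hpar).elim
  · exact good_of_rwCert2 (by omega) 1 ps hps1 fs hfs htw hN hK hb hD hrun χ hquad hprim hv

/-- **Odd characters, conductor `8m`** (two value patterns; kinds `2`, `3`): for each pattern, parity test or
reweighted certificate. [cite: MontgomeryVaughan2007, §11.2.1 Exercises 7 (g), 8] -/
theorem good_odd_of_eight_rw2 {q : ℕ} [NeZero q] (ps : List ℕ) (hps : ps.Forall fun p ↦ p.Prime ∧ p ≠ 2)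
    (hprod : 8 * ps.prod = q) (hq1 : 8 < q) (fs : List (ℕ × ℤ × ℤ)) (N K b e : ℕ) (hfs : ∀ pe ∈ fs, 2 ≤ pe.1 ∧ (pe.2.1 = 1 ∨ pe.2.1 = 0 ∨ pe.2.1 = -1) ∧ (pe.2.2 = 1 ∨ pe.2.2 = 0))
    (htw : ∀ dc ∈ twOf2 fs, dc.1 ∣ N ∧ (∀ p ∈ ps, p ∣ N / dc.1) ∧ kindPeriod 2 ∣ N / dc.1 ∧ dc.1 * q ∣ N)
    (hN : 1 ≤ N) (hK : 1 ≤ K) (hb : 2 ≤ b) (hD : (twOf2 fs).length < 2 ^ b)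
    (hA : valEightAR (resTable ps) (q - 1) = 1 ∨ blockCertD b e K N (twOf2 fs).length (rwTabs 2 b ps N (twOf2 fs)) = true)
    (hB : valEightBR (resTable ps) (q - 1) = 1 ∨ blockCertD b e K N (twOf2 fs).length (rwTabs 3 b ps N (twOf2 fs)) = true) :
    ∀ χ : DirichletCharacter ℂ q, χ.IsQuadratic → χ.IsPrimitive → χ.Odd →
      ∀ σ : ℝ, 0 < σ → σ < 1 → χ.LFunction σ ≠ 0 := by
  obtain ⟨hodd, hps1⟩ := odd_of_forall'' hps
  subst hprod
  set m := ps.prod with hm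
  haveI : NeZero m := ⟨by omega⟩
  have hm2 : m % 2 = 1 := prod_mod_two''' ps hodd
  intro χ hquad hprim hpar
  rcases re_apply_eq_valEight (m := m) (Nat.odd_iff.mpr hm2) (by omega) hprim hquad with hv | hv
  · replace hv : ∀ n : ℕ, (χ (n : ZMod (2 ^ 3 * m))).re = valEightAR (resTable ps) n := fun n ↦ by
      rw [valEightAR_eq hps hm.symm (by omega), hv]
    rcases hA with hp | hrun
    · exact fun σ _ _ => (not_odd_of_val _ hv hp hpar).elim
    · exact good_of_rwCert2 (by omega) 2 ps hps1 fs hfs htw hN hK hb hD hrun χ hquad hprim hv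
  · replace hv : ∀ n : ℕ, (χ (n : ZMod (2 ^ 3 * m))).re = valEightBR (resTable ps) n := fun n ↦ by
      rw [valEightBR_eq hps hm.symm (by omega), hv]
    rcases hB with hp | hrun
    · exact fun σ _ _ => (not_odd_of_val _ hv hp hpar).elim
    · exact good_of_rwCert2 (by omega) 3 ps hps1 fs hfs htw hN hK hb hD hrun χ hquad hprim hv

/-- **Even characters, conductor `8m`**: for each pattern, parity test or reweighted certificate.
[cite: MontgomeryVaughan2007, §11.2.1 Exercises 7 (g), 8] -/
theorem good_even_of_eight_rw2 {q : ℕ} [NeZero q] (ps : List ℕ) (hps : ps.Forall fun p ↦ p.Prime ∧ p ≠ 2)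
    (hprod : 8 * ps.prod = q) (hq1 : 8 < q) (fs : List (ℕ × ℤ × ℤ)) (N K b e : ℕ) (hfs : ∀ pe ∈ fs, 2 ≤ pe.1 ∧ (pe.2.1 = 1 ∨ pe.2.1 = 0 ∨ pe.2.1 = -1) ∧ (pe.2.2 = 1 ∨ pe.2.2 = 0))
    (htw : ∀ dc ∈ twOf2 fs, dc.1 ∣ N ∧ (∀ p ∈ ps, p ∣ N / dc.1) ∧ kindPeriod 2 ∣ N / dc.1 ∧ dc.1 * q ∣ N)
    (hN : 1 ≤ N) (hK : 1 ≤ K) (hb : 2 ≤ b) (hD : (twOf2 fs).length < 2 ^ b)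
    (hA : valEightAR (resTable ps) (q - 1) = -1 ∨ blockCertD b e K N (twOf2 fs).length (rwTabs 2 b ps N (twOf2 fs)) = true)
    (hB : valEightBR (resTable ps) (q - 1) = -1 ∨ blockCertD b e K N (twOf2 fs).length (rwTabs 3 b ps N (twOf2 fs)) = true) :
    ∀ χ : DirichletCharacter ℂ q, χ.IsQuadratic → χ.IsPrimitive → χ.Even →
      ∀ σ : ℝ, 0 < σ → σ < 1 → χ.LFunction σ ≠ 0 := by
  obtain ⟨hodd, hps1⟩ := odd_of_forall'' hps
  subst hprod
  set m := ps.prod with hm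
  haveI : NeZero m := ⟨by omega⟩
  have hm2 : m % 2 = 1 := prod_mod_two''' ps hodd
  intro χ hquad hprim hpar
  rcases re_apply_eq_valEight (m := m) (Nat.odd_iff.mpr hm2) (by omega) hprim hquad with hv | hv
  · replace hv : ∀ n : ℕ, (χ (n : ZMod (2 ^ 3 * m))).re = valEightAR (resTable ps) n := fun n ↦ by
      rw [valEightAR_eq hps hm.symm (by omega), hv]
    rcases hA with hp | hrun
    · exact fun σ _ _ => (not_even_of_val _ hv hp hpar).elim
    · exact good_of_rwCert2 (by omega) 2 ps hps1 fs hfs htw hN hK hb hD hrun χ hquad hprim hv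
  · replace hv : ∀ n : ℕ, (χ (n : ZMod (2 ^ 3 * m))).re = valEightBR (resTable ps) n := fun n ↦ by
      rw [valEightBR_eq hps hm.symm (by omega), hv]
    rcases hB with hp | hrun
    · exact fun σ _ _ => (not_even_of_val _ hv hp hpar).elim
    · exact good_of_rwCert2 (by omega) 3 ps hps1 fs hfs htw hN hK hb hD hrun χ hquad hprim hv

end FeketePolyaKernel

end Literature.NumberTheory.LFunctions
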